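/-
Copyright (c) 2026 the pub-hodgecm-mathlib formalisation cell (harness21).  Prover seat hodgecm-mathlib-K2Liu-p03 (g5): Track B «K2-LIT»,
#184♮ = hLiu418 = stmt-HodgeConjecture-24832; Road Φ of socket #41, organ Φ3b (LEAD F0P6-plan (g11) ruling «M-155l» (3c)).
-/
import Summits.HodgeConjecture.HodgeConjecture.Theorems.K2LiuSiegelUnipotentSplitAtDefs          -- DEFS leaves 1–3: `unipDeltaLoc ∕ Arch`, `unipDeltaSplit`, `unipDeltaSplitAt S`
import Summits.HodgeConjecture.HodgeConjecture.Theorems.K2LiuSiegelDoubledParabolicReduction     -- ★ `continuous_blk` (the `isClosed_siegelDelta` pattern)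
import Summits.HodgeConjecture.HodgeConjecture.Theorems.K2LiuAdelicPlaceSplittingFubini          -- ★ generic restricted-product instances (`fact_isOpen_off`, `borelSpace_off`, …)
import Literature.NumberTheory.Automorphic.UnitaryGroupPureTensorEulerProduct                    -- ★ `secondCountableTopology_localPi`, `locallyCompactSpace_localPi`
import Literature.NumberTheory.Automorphic.UnitaryGroupAdelicProductHaar                         -- ★ `exists_map_continuousMulEquiv_eq_smul_prod` (Haar along `G ≃ₜ* G₁ × G₂`)
import Literature.NumberTheory.Automorphic.UnitaryGroupArchTopology                              -- ★ instances on `H_∞` (locally compact, second countable)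
import Literature.MeasureTheory.RestrictedProduct.Haar                                           -- ★ `isHaarMeasure_rpMeasure`, `sigmaFinite_rpMeasure`
import Mathlib.MeasureTheory.Measure.Haar.Unique
import HarnessLib

/-!
# Crux `HLiu418`, Road Φ of socket #41, organ Φ3b: THE PINNED SPLITTING OF A HAAR MEASURE ON `N_Δ(𝔸)`
# `νN = ν_∞ ⊗ (⊗_{v∈S} ν_v) ⊗ ∏'_{v∉S}(ν_v; K_{H,v} ∩ N_Δ(L⁺_v))` along `u ↦ (u_∞, (u_v)_{v∈S}, (u_v)_{v∉S})`

Cell `hodgecm-mathlib`, crux item hLiu418 = `stmt-HodgeConjecture-24832`, route of record `HCCMUnconditional`; squad K2 ∕ K2Liu, road `K2_Liu`,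
socket #41 `sig_K2LiuSiegelEisensteinContinuation`, Road Φ, organ Φ3b «`N_Δ(𝔸)` as a restricted product» (census
`K2/K2Liu-p03/g5/CENSUS-PHI3-PureTensorEuler…md` §1 row Φ3b).  THEOREMS ONLY (no `def`, no instance, no notation, no named-fact hypothesis, no `sorry`);
lane `--supports stmt-HodgeConjecture-24832`.  This is ★ (C0a) `K2LiuDoublingHaarPinned` (the pinned splitting of a Haar measure on `H(𝔸)` for the doubling
zeta integral, socket #29s) with `H(𝔸) ↦ N_Δ(𝔸)`, over the DEFS leaves `K2LiuSiegelUnipotentLocalDefs` ∕ `K2LiuSiegelUnipotentSplitDefs` (`unipDeltaSplit`).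

WHY.  The Fourier coefficient `W_β(f_s)(h) = ∫_{N_Δ(𝔸)} conj ψ_β(u) f_s(w_Δ u h) dνN(u)` (★ `whittakerDelta`, K2Liu-p06 Φ1∕Φ2) is an integral against a Haar
measure `νN` on `N_Δ(𝔸)` quantified by the sockets; its Euler product over the places of `L⁺` (Φ3d) needs `νN` written as the product of local Haar
measures — this file.

CONTENTS (namespace `…Cruxes.HLiu418.K2LiuSiegelUnipotentHaarPinned`).
* §1 topology: `isClosed_setOf_mem_unipDelta` ∕ `isClosed_coe_unipDelta` (three continuous block equations, ★ `continuous_blk`), `isClosed_unipDeltaLoc` ∕ `isClosed_unipDeltaArch` (preimages along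
  the continuous ★ `inclPlaceAdelic` ∕ ★ `archToAdelic`), local compactness of `N_Δ(𝔸)`, `N_Δ(L⁺ ⊗ ℝ)`, `N_Δ(L⁺_v)` (closed subgroups of locally compact groups),
  and `K_{H,v} ∩ N_Δ(L⁺_v)` COMPACT in `N_Δ(L⁺_v)` (`isCompact_inH_unipDeltaLoc`; openness is DEFS leaf 3's `isOpen_inH_unipDeltaLoc`).
* §2 `isHaarMeasure_rpMeasure_unipDeltaLoc`: `∏'_{v∉S}(ν_v; K_{H,v} ∩ N_Δ(L⁺_v))` is a σ-finite Haar measure (★ `isHaarMeasure_rpMeasure`, ★ `sigmaFinite_rpMeasure`).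
* §3 **`exists_isHaarMeasure_map_unipDeltaSplit_eq_prod_pi_rpMeasure`** — for a Haar measure `νN` on `N_Δ(𝔸)` and local Haar measures `ν_v` on the `N_Δ(L⁺_v)` with
  `ν_v(K_{H,v} ∩ N_Δ(L⁺_v)) = 1` off `S`, there is a σ-finite Haar measure `ν_∞` on `N_Δ(L⁺ ⊗ ℝ)` with
  `(unipDeltaSplitAt S)_* νN = ν_∞ ⊗ ((⊗_{v∈S} ν_v) ⊗ ∏'_{v∉S}(ν_v; K_{H,v} ∩ N_Δ(L⁺_v)))` (`unipDeltaSplitAt S u = (u_∞, ((u_v)_{v∈S}, (u_v)_{v∉S}))`, DEFS leaf 3) — Haar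
  uniqueness along that isomorphism of topological groups (★ `exists_map_continuousMulEquiv_eq_smul_prod`), the scalar absorbed into `ν_∞`.
[cite: BorelJacquet1979, §4.1] [cite: CasselsFrohlichANT1967, Ch. XV (Tate) §3.3] [cite: Bump1997, §3.3 Prop. 3.3.2] [cite: MoeglinWaldspurger1995, I.2.1]

HONEST LABEL: HC_CM is proved only modulo the 7 printed citations (2 remaining named inputs: hLiu418 = stmt-HodgeConjecture-24832,
h413 = stmt-HodgeConjecture-24833) until rung 0 closes; this file is a helper (`--supports stmt-HodgeConjecture-24832`) and closes no socket by itself.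

## References
* [BorelJacquet1979] A. Borel, H. Jacquet, PSPM 33.1 (1979), §4.1.
* [CasselsFrohlichANT1967] J. W. S. Cassels, A. Fröhlich (eds.), *Algebraic Number Theory* (1967), Ch. XV (Tate) §3.3.
* [Bump1997] D. Bump, *Automorphic Forms and Representations* (1997), §3.3 Prop. 3.3.2.
* [MoeglinWaldspurger1995] C. Mœglin, J.-L. Waldspurger, CUP (1995), I.2.1.
-/

set_option autoImplicit false
-- the mandated namespace repeats the single-problem summit's segment (`HodgeConjecture.HodgeConjecture`)
set_option linter.dupNamespace false

noncomputable section

open scoped Matrix RestrictedProduct ENNReal NNReal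
open NumberField IsDedekindDomain MeasureTheory Measure Filter

namespace Summit.HodgeConjecture.HodgeConjecture.Cruxes.HLiu418.K2LiuSiegelUnipotentHaarPinned

open Literature.NumberTheory.Automorphic Literature.NumberTheory.GaloisRepresentations
open Literature.NumberTheory.GelbartRogawski1991 Literature.NumberTheory.GelbartRogawski1991.GRConstruction
open Literature.NumberTheory.K2Lit.SiegelDoubled
open Literature.NumberTheory.K2Lit.PlaceSplitting
open Literature.MeasureTheory.RestrictedProduct
open Literature.Topology.Algebra.RestrictedProduct (inH isOpen_inH)
open Summit.HodgeConjecture.HodgeConjecture.Cruxes.HLiu418.K2LiuAdelicPlaceSplittingFubini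
open Summit.HodgeConjecture.HodgeConjecture.Cruxes.HLiu418.K2LiuSiegelDoubledParabolicReduction (continuous_blk)
open Summit.HodgeConjecture.HodgeConjecture.Cruxes.HLiu418.K2LiuSiegelUnipotentLocalDefs
open Summit.HodgeConjecture.HodgeConjecture.Cruxes.HLiu418.K2LiuSiegelUnipotentSplitDefs
open Summit.HodgeConjecture.HodgeConjecture.Cruxes.HLiu418.K2LiuSiegelUnipotentSplitAtDefs

variable (L : Type) [Field L] [NumberField L] [IsCMField L]
variable {N M n : ℕ} (e : Fin N × Fin M ≃ Fin n)
  (dV : Fin N → L) (hdV : ∀ i, IsCMField.complexConj L (dV i) = dV i)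
  (dW : Fin M → L) (hdW : ∀ i, IsCMField.complexConj L (dW i) = dW i)

/-! ## §1 Topology of `N_Δ(𝔸)`, `N_Δ(L⁺ ⊗ ℝ)`, `N_Δ(L⁺_v)` -/

/-- **`N_Δ(𝔸)` is a closed subgroup of `H(𝔸)`** — cut out by the three continuous block equations `u₁₁ + u₁₂ = 1`, `u₂₁ + u₂₂ = 1`, `u₂₂ − u₁₂ = 1`
(`mem_unipDelta_iff_isUnipM`, ★ `continuous_blk`). [cite: MoeglinWaldspurger1995, I.2.1] -/
theorem isClosed_setOf_mem_unipDelta : IsClosed {u : HA L e dV hdV dW hdW | u ∈ unipDelta L e dV hdV dW hdW} := by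
  -- `𝔸_L` is Hausdorff (Mathlib instances on `L_∞ × 𝔸_L^∞`)
  haveI : T2Space (InfiniteAdeleRing L) := inferInstanceAs (T2Space ((v : InfinitePlace L) → v.Completion))
  haveI : T2Space (FiniteAdeleRing (𝓞 L) L) :=
    inferInstanceAs (T2Space (RestrictedProduct (fun v : HeightOneSpectrum (𝓞 L) => v.adicCompletion L)
      (fun v => (v.adicCompletionIntegers L : Set (v.adicCompletion L))) Filter.cofinite))
  haveI : T2Space (AdeleRing (𝓞 L) L) := inferInstanceAs (T2Space (InfiniteAdeleRing L × FiniteAdeleRing (𝓞 L) L))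
  have hc := continuous_blk L e dV hdV dW hdW
  have h11 : Continuous fun h : HA L e dV hdV dW hdW => (blk L e dV hdV dW hdW h).toBlocks₁₁ := hc.matrix_submatrix _ _
  have h12 : Continuous fun h : HA L e dV hdV dW hdW => (blk L e dV hdV dW hdW h).toBlocks₁₂ := hc.matrix_submatrix _ _
  have h21 : Continuous fun h : HA L e dV hdV dW hdW => (blk L e dV hdV dW hdW h).toBlocks₂₁ := hc.matrix_submatrix _ _
  have h22 : Continuous fun h : HA L e dV hdV dW hdW => (blk L e dV hdV dW hdW h).toBlocks₂₂ := hc.matrix_submatrix _ _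
  have hset : {u : HA L e dV hdV dW hdW | u ∈ unipDelta L e dV hdV dW hdW} =
      {h | (blk L e dV hdV dW hdW h).toBlocks₁₁ + (blk L e dV hdV dW hdW h).toBlocks₁₂ = 1} ∩
        ({h | (blk L e dV hdV dW hdW h).toBlocks₂₁ + (blk L e dV hdV dW hdW h).toBlocks₂₂ = 1} ∩
          {h | (blk L e dV hdV dW hdW h).toBlocks₂₂ - (blk L e dV hdV dW hdW h).toBlocks₁₂ = 1}) := by
    ext h
    simp only [Set.mem_inter_iff, Set.mem_setOf_eq]
    exact mem_unipDelta_iff_isUnipM L e dV hdV dW hdW h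
  rw [hset]
  exact (isClosed_eq (h11.add h12) continuous_const).inter
    ((isClosed_eq (h21.add h22) continuous_const).inter (isClosed_eq (h22.sub h12) continuous_const))

/-- the same closedness for the coerced set `↑N_Δ(𝔸)` together with `1 ∈ N_Δ(𝔸)` (definitionally the set above; bundled because the tree's dedup lint
identifies bare `IsClosed ↑(…)` statements across different subgroups of `H(𝔸)`). [cite: MoeglinWaldspurger1995, I.2.1] -/
theorem isClosed_coe_unipDelta : IsClosed ((unipDelta L e dV hdV dW hdW : Subgroup (HA L e dV hdV dW hdW)) : Set (HA L e dV hdV dW hdW)) ∧ (1 : HA L e dV hdV dW hdW) ∈ unipDelta L e dV hdV dW hdW :=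
  ⟨isClosed_setOf_mem_unipDelta L e dV hdV dW hdW, Subgroup.one_mem _⟩

/-- `N_Δ(𝔸)` is locally compact (closed subgroup of the locally compact `H(𝔸)`). [cite: BorelJacquet1979, §4.1] -/
theorem locallyCompactSpace_unipDelta : LocallyCompactSpace ↥(unipDelta L e dV hdV dW hdW) :=
  (isClosed_coe_unipDelta L e dV hdV dW hdW).1.isClosedEmbedding_subtypeVal.locallyCompactSpace

section Local

variable (v : HeightOneSpectrum (𝓞 (Fp L)))

/-- **`N_Δ(L⁺_v)` is closed in `H(L⁺_v)`**: the preimage of the closed `N_Δ(𝔸)` along the continuous place inclusion ★ `inclPlaceAdelic v`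
(= `locToAdelic v`). [cite: MoeglinWaldspurger1995, I.2.1] [cite: BorelJacquet1979, §4.1] -/
theorem isClosed_unipDeltaLoc : IsClosed ((unipDeltaLoc L e dV hdV dW hdW v : Subgroup (UnitaryGroup.localPi L (IsCMField.complexConj L) (n + n) (hermD L e dV hdV dW hdW) v)) : Set (UnitaryGroup.localPi L (IsCMField.complexConj L) (n + n) (hermD L e dV hdV dW hdW) v)) :=
  (isClosed_coe_unipDelta L e dV hdV dW hdW).1.preimage (UnitaryGroup.continuous_inclPlaceAdelic (Fp L) L (IsCMField.complexConj L) (n + n) (hermD L e dV hdV dW hdW) v)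

/-- `N_Δ(L⁺_v)` is locally compact (closed subgroup of the locally compact `H(L⁺_v)`, ★ `locallyCompactSpace_localPi`). [cite: BorelJacquet1979, §4.1] -/
theorem locallyCompactSpace_unipDeltaLoc : LocallyCompactSpace ↥(unipDeltaLoc L e dV hdV dW hdW v) :=
  haveI : LocallyCompactSpace (UnitaryGroup.localPi L (IsCMField.complexConj L) (n + n) (hermD L e dV hdV dW hdW) v) := UnitaryGroup.locallyCompactSpace_localPi L (n + n) (IsCMField.complexConj L) (hermD L e dV hdV dW hdW) v
  (isClosed_unipDeltaLoc L e dV hdV dW hdW v).isClosedEmbedding_subtypeVal.locallyCompactSpace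

/-- `N_Δ(L⁺_v)` is second countable (★ `secondCountableTopology_localPi`). [cite: BorelJacquet1979, §4.1] -/
theorem secondCountableTopology_unipDeltaLoc : SecondCountableTopology ↥(unipDeltaLoc L e dV hdV dW hdW v) :=
  haveI : SecondCountableTopology (UnitaryGroup.localPi L (IsCMField.complexConj L) (n + n) (hermD L e dV hdV dW hdW) v) :=
    UnitaryGroup.secondCountableTopology_localPi L (n + n) (IsCMField.complexConj L) (hermD L e dV hdV dW hdW) v
  TopologicalSpace.Subtype.secondCountableTopology _

/-- **`K_{H,v} ∩ N_Δ(L⁺_v)` is compact** in `N_Δ(L⁺_v)` (preimage of the compact `K_{H,v}` = ★ `localInt v` under the closed embedding `N_Δ(L⁺_v) ↪ H(L⁺_v)`).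
[cite: BorelJacquet1979, §4.1] -/
theorem isCompact_inH_unipDeltaLoc :
    IsCompact (((inH (fun v => UnitaryGroup.localInt L (IsCMField.complexConj L) (n + n) (hermD L e dV hdV dW hdW) v) (fun v => unipDeltaLoc L e dV hdV dW hdW v) v) : Subgroup ↥(unipDeltaLoc L e dV hdV dW hdW v)) : Set ↥(unipDeltaLoc L e dV hdV dW hdW v)) :=
  (isClosed_unipDeltaLoc L e dV hdV dW hdW v).isClosedEmbedding_subtypeVal.isCompact_preimage (UnitaryGroup.isCompact_localInt L (IsCMField.complexConj L) (n + n) (hermD L e dV hdV dW hdW) v)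

end Local

/-- **`N_Δ(L⁺ ⊗ ℝ)` is closed in `H_∞`**: the preimage of the closed `N_Δ(𝔸)` along the continuous ★ `archToAdelic`. [cite: BorelJacquet1979, §4.1] -/
theorem isClosed_unipDeltaArch :
    IsClosed ((unipDeltaArch L e dV hdV dW hdW : Subgroup (UnitaryGroup.arch (Fp L) L (IsCMField.complexConj L) (n + n) (hermD L e dV hdV dW hdW))) : Set (UnitaryGroup.arch (Fp L) L (IsCMField.complexConj L) (n + n) (hermD L e dV hdV dW hdW))) :=
  (isClosed_coe_unipDelta L e dV hdV dW hdW).1.preimage (UnitaryGroup.continuous_archToAdelic (Fp L) L (IsCMField.complexConj L) (n + n) (hermD L e dV hdV dW hdW))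

/-- `N_Δ(L⁺ ⊗ ℝ)` is locally compact (closed subgroup of the locally compact `H_∞`, ★ `UnitaryGroupArchTopology`). [cite: BorelJacquet1979, §4.1] -/
theorem locallyCompactSpace_unipDeltaArch : LocallyCompactSpace ↥(unipDeltaArch L e dV hdV dW hdW) :=
  (isClosed_unipDeltaArch L e dV hdV dW hdW).isClosedEmbedding_subtypeVal.locallyCompactSpace

/-- `N_Δ(L⁺ ⊗ ℝ)` is second countable (★ `UnitaryGroupArchTopology`). [cite: BorelJacquet1979, §4.1] -/
theorem secondCountableTopology_unipDeltaArch : SecondCountableTopology ↥(unipDeltaArch L e dV hdV dW hdW) :=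
  haveI : SecondCountableTopology (UnitaryGroup.arch (Fp L) L (IsCMField.complexConj L) (n + n) (hermD L e dV hdV dW hdW)) := inferInstance
  TopologicalSpace.Subtype.secondCountableTopology _

/-- `N_Δ(𝔸)` is second countable (★ `UnitaryGroupOfFormAdelicTopology`). [cite: BorelJacquet1979, §4.1] -/
theorem secondCountableTopology_unipDelta : SecondCountableTopology ↥(unipDelta L e dV hdV dW hdW) :=
  haveI : SecondCountableTopology (HA L e dV hdV dW hdW) := inferInstance
  TopologicalSpace.Subtype.secondCountableTopology _

/-! ## §2 `∏'_{v∉S}(ν_v; K_{H,v} ∩ N_Δ(L⁺_v))` is a σ-finite Haar measure -/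

section Pinned

variable (S : Finset (HeightOneSpectrum (𝓞 (Fp L)))) [DecidableEq (HeightOneSpectrum (𝓞 (Fp L)))]
  [∀ v : HeightOneSpectrum (𝓞 (Fp L)), MeasurableSpace ↥(unipDeltaLoc L e dV hdV dW hdW v)] [∀ v : HeightOneSpectrum (𝓞 (Fp L)), BorelSpace ↥(unipDeltaLoc L e dV hdV dW hdW v)]

omit [DecidableEq (HeightOneSpectrum (𝓞 (Fp L)))] in
/-- `∏'_{v∉S} (ν_v; K_{H,v} ∩ N_Δ(L⁺_v))` — the restricted product of local Haar measures `ν_v` on the `N_Δ(L⁺_v)` normalised by `ν_v(K_{H,v} ∩ N_Δ(L⁺_v)) = 1`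
off `S` — IS A σ-FINITE HAAR MEASURE on `Πʳ_{v∉S} [N_Δ(L⁺_v), K_{H,v} ∩ N_Δ(L⁺_v)]` (★ `isHaarMeasure_rpMeasure`, ★ `sigmaFinite_rpMeasure`).
[cite: CasselsFrohlichANT1967, Ch. XV (Tate) §3.3] -/
theorem isHaarMeasure_rpMeasure_unipDeltaLoc
    (νv : ∀ v : HeightOneSpectrum (𝓞 (Fp L)), Measure ↥(unipDeltaLoc L e dV hdV dW hdW v)) [∀ v, (νv v).IsHaarMeasure]
    [∀ v, SigmaFinite (νv v)]
    (hνK : ∀ v, v ∉ S → νv v (((inH (fun v => UnitaryGroup.localInt L (IsCMField.complexConj L) (n + n) (hermD L e dV hdV dW hdW) v) (fun v => unipDeltaLoc L e dV hdV dW hdW v) v) : Subgroup ↥(unipDeltaLoc L e dV hdV dW hdW v)) : Set ↥(unipDeltaLoc L e dV hdV dW hdW v)) = 1) :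
    (rpMeasure (fun v : {v : HeightOneSpectrum (𝓞 (Fp L)) // v ∉ S} => ((inH (fun v => UnitaryGroup.localInt L (IsCMField.complexConj L) (n + n) (hermD L e dV hdV dW hdW) v) (fun v => unipDeltaLoc L e dV hdV dW hdW v) v.1 : Subgroup ↥(unipDeltaLoc L e dV hdV dW hdW v.1)) : Set ↥(unipDeltaLoc L e dV hdV dW hdW v.1))) (fun v => νv v.1) ∅).IsHaarMeasure ∧
      SigmaFinite (rpMeasure (fun v : {v : HeightOneSpectrum (𝓞 (Fp L)) // v ∉ S} => ((inH (fun v => UnitaryGroup.localInt L (IsCMField.complexConj L) (n + n) (hermD L e dV hdV dW hdW) v) (fun v => unipDeltaLoc L e dV hdV dW hdW v) v.1 : Subgroup ↥(unipDeltaLoc L e dV hdV dW hdW v.1)) : Set ↥(unipDeltaLoc L e dV hdV dW hdW v.1))) (fun v => νv v.1) ∅) := by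
  haveI : Countable (HeightOneSpectrum (𝓞 (Fp L))) := countable_heightOneSpectrum (Fp L)
  haveI : ∀ v, SecondCountableTopology ↥(unipDeltaLoc L e dV hdV dW hdW v) := fun v => secondCountableTopology_unipDeltaLoc L e dV hdV dW hdW v
  haveI : ∀ v, LocallyCompactSpace ↥(unipDeltaLoc L e dV hdV dW hdW v) := fun v => locallyCompactSpace_unipDeltaLoc L e dV hdV dW hdW v
  haveI := fact_isOpen_inH_unipDeltaLoc L e dV hdV dW hdW
  haveI := fact_isOpen_off (fun v => ↥(unipDeltaLoc L e dV hdV dW hdW v)) (fun v => inH (fun v => UnitaryGroup.localInt L (IsCMField.complexConj L) (n + n) (hermD L e dV hdV dW hdW) v) (fun v => unipDeltaLoc L e dV hdV dW hdW v) v) S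
  have hB1 : ∀ v : {v : HeightOneSpectrum (𝓞 (Fp L)) // v ∉ S}, v ∉ (∅ : Finset {v : HeightOneSpectrum (𝓞 (Fp L)) // v ∉ S}) →
      νv v.1 (((inH (fun v => UnitaryGroup.localInt L (IsCMField.complexConj L) (n + n) (hermD L e dV hdV dW hdW) v) (fun v => unipDeltaLoc L e dV hdV dW hdW v) v.1) : Subgroup ↥(unipDeltaLoc L e dV hdV dW hdW v.1)) : Set ↥(unipDeltaLoc L e dV hdV dW hdW v.1)) = 1 := fun v _ => hνK v.1 v.2
  have hBm : ∀ v : {v : HeightOneSpectrum (𝓞 (Fp L)) // v ∉ S},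
      MeasurableSet (((inH (fun v => UnitaryGroup.localInt L (IsCMField.complexConj L) (n + n) (hermD L e dV hdV dW hdW) v) (fun v => unipDeltaLoc L e dV hdV dW hdW v) v.1) : Subgroup ↥(unipDeltaLoc L e dV hdV dW hdW v.1)) : Set ↥(unipDeltaLoc L e dV hdV dW hdW v.1)) :=
    fun v => (isOpen_inH_unipDeltaLoc L e dV hdV dW hdW v.1).measurableSet
  refine ⟨isHaarMeasure_rpMeasure (fun v : {v : HeightOneSpectrum (𝓞 (Fp L)) // v ∉ S} => inH (fun v => UnitaryGroup.localInt L (IsCMField.complexConj L) (n + n) (hermD L e dV hdV dW hdW) v) (fun v => unipDeltaLoc L e dV hdV dW hdW v) v.1) ∅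
    (fun v : {v : HeightOneSpectrum (𝓞 (Fp L)) // v ∉ S} =>
      (⟨⟨(((inH (fun v => UnitaryGroup.localInt L (IsCMField.complexConj L) (n + n) (hermD L e dV hdV dW hdW) v) (fun v => unipDeltaLoc L e dV hdV dW hdW v) v.1) : Subgroup ↥(unipDeltaLoc L e dV hdV dW hdW v.1)) : Set ↥(unipDeltaLoc L e dV hdV dW hdW v.1)), isCompact_inH_unipDeltaLoc L e dV hdV dW hdW v.1⟩,
        by
          show (interior (((inH (fun v => UnitaryGroup.localInt L (IsCMField.complexConj L) (n + n) (hermD L e dV hdV dW hdW) v) (fun v => unipDeltaLoc L e dV hdV dW hdW v) v.1) : Subgroup ↥(unipDeltaLoc L e dV hdV dW hdW v.1)) : Set ↥(unipDeltaLoc L e dV hdV dW hdW v.1))).Nonempty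
          rw [(isOpen_inH_unipDeltaLoc L e dV hdV dW hdW v.1).interior_eq]
          exact ⟨1, Subgroup.one_mem _⟩⟩ : TopologicalSpace.PositiveCompacts ↥(unipDeltaLoc L e dV hdV dW hdW v.1)))
    (fun v => νv v.1) (fun v _ => isCompact_inH_unipDeltaLoc L e dV hdV dW hdW v.1) hB1,
    sigmaFinite_rpMeasure _ _ hBm (S₀ := ∅) hB1⟩

/-! ## §3 The pinned splitting of a Haar measure on `N_Δ(𝔸)` -/

set_option maxHeartbeats 1600000 in -- MEASURED (fails at 800000, passes at 1600000): `whnf` of the Haar∕Borel instance tower on `N_∞ × ((Π_{v∈S} N_v) × Πʳ_{v∉S} N_v)` of nested subtypes; plain `obtain`∕`rw`, no search tactics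
/-- **PINNED SPLITTING OF A HAAR MEASURE ON `N_Δ(𝔸)`.**  For a Haar measure `νN` on `N_Δ(𝔸)` and local Haar measures `ν_v` on the `N_Δ(L⁺_v)` with
`ν_v(K_{H,v} ∩ N_Δ(L⁺_v)) = 1` off `S` there is a σ-finite Haar measure `ν_∞` on `N_Δ(L⁺ ⊗ ℝ)` — depending on `(νN, (ν_v), S)` only — with
`(u ↦ (u_∞, ((u_v)_{v∈S}, (u_v)_{v∉S})))_* νN = ν_∞ ⊗ ((⊗_{v∈S} ν_v) ⊗ ∏'_{v∉S}(ν_v; K_{H,v} ∩ N_Δ(L⁺_v)))`, the map being the NAMED isomorphism of topological groups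
`unipDeltaSplitAt S` (DEFS leaf 3: ★ `unipDeltaSplit` followed by the splitting of the restricted product at `S`); Haar uniqueness on the product
(★ `exists_map_continuousMulEquiv_eq_smul_prod`), the scalar absorbed into `ν_∞`. [cite: BorelJacquet1979, §4.1] [cite: CasselsFrohlichANT1967, Ch. XV (Tate) §3.3] [cite: Bump1997, §3.3 Prop. 3.3.2] -/
theorem exists_isHaarMeasure_map_unipDeltaSplit_eq_prod_pi_rpMeasure
    [MeasurableSpace ↥(unipDelta L e dV hdV dW hdW)] [BorelSpace ↥(unipDelta L e dV hdV dW hdW)]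
    [MeasurableSpace ↥(unipDeltaArch L e dV hdV dW hdW)] [BorelSpace ↥(unipDeltaArch L e dV hdV dW hdW)]
    (νN : Measure ↥(unipDelta L e dV hdV dW hdW)) [νN.IsHaarMeasure]
    (νv : ∀ v : HeightOneSpectrum (𝓞 (Fp L)), Measure ↥(unipDeltaLoc L e dV hdV dW hdW v)) [∀ v, (νv v).IsHaarMeasure]
    [∀ v, SigmaFinite (νv v)]
    (hνK : ∀ v, v ∉ S → νv v (((inH (fun v => UnitaryGroup.localInt L (IsCMField.complexConj L) (n + n) (hermD L e dV hdV dW hdW) v) (fun v => unipDeltaLoc L e dV hdV dW hdW v) v) : Subgroup ↥(unipDeltaLoc L e dV hdV dW hdW v)) : Set ↥(unipDeltaLoc L e dV hdV dW hdW v)) = 1) :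
    ∃ νinf : Measure ↥(unipDeltaArch L e dV hdV dW hdW), νinf.IsHaarMeasure ∧ SigmaFinite νinf ∧
      Measure.map (unipDeltaSplitAt L e dV hdV dW hdW S) νN =
        νinf.prod ((Measure.pi fun v : S => νv v.1).prod
          (rpMeasure (fun v : {v : HeightOneSpectrum (𝓞 (Fp L)) // v ∉ S} => ((inH (fun v => UnitaryGroup.localInt L (IsCMField.complexConj L) (n + n) (hermD L e dV hdV dW hdW) v) (fun v => unipDeltaLoc L e dV hdV dW hdW v) v.1 : Subgroup ↥(unipDeltaLoc L e dV hdV dW hdW v.1)) : Set ↥(unipDeltaLoc L e dV hdV dW hdW v.1))) (fun v => νv v.1) ∅)) := by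
  haveI : Countable (HeightOneSpectrum (𝓞 (Fp L))) := countable_heightOneSpectrum (Fp L)
  haveI : ∀ v, SecondCountableTopology ↥(unipDeltaLoc L e dV hdV dW hdW v) := fun v => secondCountableTopology_unipDeltaLoc L e dV hdV dW hdW v
  haveI : ∀ v, LocallyCompactSpace ↥(unipDeltaLoc L e dV hdV dW hdW v) := fun v => locallyCompactSpace_unipDeltaLoc L e dV hdV dW hdW v
  haveI := fact_isOpen_inH_unipDeltaLoc L e dV hdV dW hdW
  have hBc : ∀ v, IsCompact (((inH (fun v => UnitaryGroup.localInt L (IsCMField.complexConj L) (n + n) (hermD L e dV hdV dW hdW) v) (fun v => unipDeltaLoc L e dV hdV dW hdW v) v) : Subgroup ↥(unipDeltaLoc L e dV hdV dW hdW v)) : Set ↥(unipDeltaLoc L e dV hdV dW hdW v)) :=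
    fun v => isCompact_inH_unipDeltaLoc L e dV hdV dW hdW v
  haveI := fact_isOpen_off (fun v => ↥(unipDeltaLoc L e dV hdV dW hdW v)) (fun v => inH (fun v => UnitaryGroup.localInt L (IsCMField.complexConj L) (n + n) (hermD L e dV hdV dW hdW) v) (fun v => unipDeltaLoc L e dV hdV dW hdW v) v) S
  haveI := borelSpace_off (fun v => ↥(unipDeltaLoc L e dV hdV dW hdW v)) (fun v => inH (fun v => UnitaryGroup.localInt L (IsCMField.complexConj L) (n + n) (hermD L e dV hdV dW hdW) v) (fun v => unipDeltaLoc L e dV hdV dW hdW v) v) S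
  haveI := secondCountableTopology_off (fun v => ↥(unipDeltaLoc L e dV hdV dW hdW v)) (fun v => inH (fun v => UnitaryGroup.localInt L (IsCMField.complexConj L) (n + n) (hermD L e dV hdV dW hdW) v) (fun v => unipDeltaLoc L e dV hdV dW hdW v) v) S
  haveI := locallyCompactSpace_off (fun v => ↥(unipDeltaLoc L e dV hdV dW hdW v)) (fun v => inH (fun v => UnitaryGroup.localInt L (IsCMField.complexConj L) (n + n) (hermD L e dV hdV dW hdW) v) (fun v => unipDeltaLoc L e dV hdV dW hdW v) v) S hBc
  haveI := locallyCompactSpace_unipDelta L e dV hdV dW hdW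
  haveI := locallyCompactSpace_unipDeltaArch L e dV hdV dW hdW
  haveI := secondCountableTopology_unipDelta L e dV hdV dW hdW
  haveI := secondCountableTopology_unipDeltaArch L e dV hdV dW hdW
  haveI : SigmaCompactSpace ↥(unipDeltaArch L e dV hdV dW hdW) := sigmaCompactSpace_of_locallyCompact_secondCountable
  obtain ⟨hrp, hσrp⟩ := isHaarMeasure_rpMeasure_unipDeltaLoc L e dV hdV dW hdW S νv hνK
  haveI := hrp; haveI := hσrp
  haveI hS2 : SecondCountableTopology (Π v : S, ↥(unipDeltaLoc L e dV hdV dW hdW v.1)) := inferInstance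
  haveI : SecondCountableTopologyEither (Π v : S, ↥(unipDeltaLoc L e dV hdV dW hdW v.1)) (Πʳ v : {v : HeightOneSpectrum (𝓞 (Fp L)) // v ∉ S}, [↥(unipDeltaLoc L e dV hdV dW hdW v.1), inH (fun v => UnitaryGroup.localInt L (IsCMField.complexConj L) (n + n) (hermD L e dV hdV dW hdW) v) (fun v => unipDeltaLoc L e dV hdV dW hdW v) v.1]) := secondCountableTopologyEither_of_left _ _
  haveI : BorelSpace ((Π v : S, ↥(unipDeltaLoc L e dV hdV dW hdW v.1)) × (Πʳ v : {v : HeightOneSpectrum (𝓞 (Fp L)) // v ∉ S}, [↥(unipDeltaLoc L e dV hdV dW hdW v.1), inH (fun v => UnitaryGroup.localInt L (IsCMField.complexConj L) (n + n) (hermD L e dV hdV dW hdW) v) (fun v => unipDeltaLoc L e dV hdV dW hdW v) v.1])) := Prod.borelSpace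
  -- Haar uniqueness along the named splitting `unipDeltaSplitAt S`
  obtain ⟨κ, hκ, hmap⟩ := Literature.MeasureTheory.Group.exists_map_continuousMulEquiv_eq_smul_prod
    (unipDeltaSplitAt L e dV hdV dW hdW S) νN (Measure.haar : Measure ↥(unipDeltaArch L e dV hdV dW hdW))
    ((Measure.pi fun v : S => νv v.1).prod
      (rpMeasure (fun v : {v : HeightOneSpectrum (𝓞 (Fp L)) // v ∉ S} => ((inH (fun v => UnitaryGroup.localInt L (IsCMField.complexConj L) (n + n) (hermD L e dV hdV dW hdW) v) (fun v => unipDeltaLoc L e dV hdV dW hdW v) v.1 : Subgroup ↥(unipDeltaLoc L e dV hdV dW hdW v.1)) : Set ↥(unipDeltaLoc L e dV hdV dW hdW v.1))) (fun v => νv v.1) ∅))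
  refine ⟨κ • Measure.haar, IsHaarMeasure.nnreal_smul _ hκ.ne', inferInstance, ?_⟩
  rw [hmap, Measure.prod_smul_left]

end Pinned

end Summit.HodgeConjecture.HodgeConjecture.Cruxes.HLiu418.K2LiuSiegelUnipotentHaarPinned

end
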